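import Summits.QuantumFields.YangMills.Theses.ModerateWindow

/-!
# Crux `HistoryTailL` (stmt-QuantumFields-19936) — LINE «moderate-window» (ideator seat ym-r3-idea-2 g4, lens «nearmiss»)

The line IS route `ModerateWindow` (route-QuantumFields-ModerateWindow, DRAFT, tribunal pending; critic idea-crit-5 to vet): its crux `WindowMGFL`
(rank 2) split into the two REGIME STUBS of its birth skeleton (fine half `2j ≤ K`, deep half `K < 2j`, monotone closure so the
join `WindowMGFL_of` is pure logic), plus the glue item `HistoryTailOfWindow` (support r9, provable now) BY NAME, give
`UnitScaleTilt.HistoryTailL` BY NAME.  Sorries ONLY inside `stub_*`.  No summit, no rung (`YM3TorusSU2`), no mass gap is proved;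
`HistoryTailL` stays open behind the stubs.
-/

namespace Summit.QuantumFields.YangMills.Cruxes.HistoryTailL.ModerateWindow

open scoped BigOperators Topology Classical MeasureTheory ProbabilityTheory Matrix
open Filter Set Function TopologicalSpace MeasureTheory
open Summit.QuantumFields.YangMills.Theses.ModerateWindow (WindowMGFL HistoryTailOfWindow)

/-! ## §1 The registered stubs (the ONLY sorries) -/

/-- stub (M, = item `HistoryTailOfWindow`, support r9 of route `ModerateWindow`: Chernoff/Chebyshev + the landed union-bound schema). -/
theorem stub_historyTailOfWindow : HistoryTailOfWindow := by
  sorry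

/-- STUB 1 (fine half, heights `K − j ≥ j`): the windowed sub-Gaussian moment bound with few integrated levels (capped quadratic
tilt at scale g_(K−j)), monotone closure in (ε, H, A). -/
theorem stub_fineWindow : open Literature.MathematicalPhysics.QuantumFieldTheory.Balaban1983to89 Literature.MathematicalPhysics.QuantumFieldTheory.Balaban1983to89.T3ContinuumYM3Torus in ∀ (L : ℕ), ∃ ε₀ : ℝ, 0 < ε₀ ∧ ∀ (ε : ℝ), 0 < ε → ε ≤ ε₀ → ∃ γ₁ : ℝ, 0 < γ₁ ∧ γ₁ ≤ 1 ∧ ∀ (F : T3Family) (γ : ℝ), F.L = L → 0 < γ → γ ≤ γ₁ → ∃ H₀ : ℝ, 0 < H₀ ∧ ∀ (H : ℝ), H₀ ≤ H → ∃ A₀ : ℕ, ∀ (A : ℕ), A₀ ≤ A → ∃ D : ℝ, 0 ≤ D ∧ ∀ (K j : ℕ), 1 ≤ j → j ≤ K → 2 * j ≤ K → ∀ (p : Plaq (F.P K) j) (t : ℝ), 0 ≤ t → t ≤ (F.scheme T3UnitLawDensityEML.ℰp γ).β (K - j) ^ ε → ∫ U, Real.exp (t * (GaugeGroup.dist1 (GaugeField.plaqHol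 (Averaging.iter (fun i => BlockAveraging.blockAvg (P := F.P K) (j := i) T3UnitLawDensityEML.ℰp) j U) p) / Real.sqrt (γ * ((F.L : ℝ)⁻¹) ^ (K - j)))) ∂(T3UnitScaleTilt.gibbsK F T3UnitLawDensityEML.ℰp γ K) ≤ D * (F.scheme T3UnitLawDensityEML.ℰp γ).β (K - j) ^ A * Real.exp (H * t ^ 2) := by
  sorry

/-- STUB 2 (deep half, heights `K − j < j`): the windowed bound after many integrated levels — ONE-STEP TRANSFER under block
averaging (variance proxies add, H_(j+1) ≤ H_j·(1 + c·L^(−(K−j)))) iterated; the load-bearing stub. -/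
theorem stub_deepWindow : open Literature.MathematicalPhysics.QuantumFieldTheory.Balaban1983to89 Literature.MathematicalPhysics.QuantumFieldTheory.Balaban1983to89.T3ContinuumYM3Torus in ∀ (L : ℕ), ∃ ε₀ : ℝ, 0 < ε₀ ∧ ∀ (ε : ℝ), 0 < ε → ε ≤ ε₀ → ∃ γ₁ : ℝ, 0 < γ₁ ∧ γ₁ ≤ 1 ∧ ∀ (F : T3Family) (γ : ℝ), F.L = L → 0 < γ → γ ≤ γ₁ → ∃ H₀ : ℝ, 0 < H₀ ∧ ∀ (H : ℝ), H₀ ≤ H → ∃ A₀ : ℕ, ∀ (A : ℕ), A₀ ≤ A → ∃ D : ℝ, 0 ≤ D ∧ ∀ (K j : ℕ), 1 ≤ j → j ≤ K → K < 2 * j → ∀ (p : Plaq (F.P K) j) (t : ℝ), 0 ≤ t → t ≤ (F.scheme T3UnitLawDensityEML.ℰp γ).β (K - j) ^ ε → ∫ U, Real.exp (t * (GaugeGroup.dist1 (GaugeField.plaqHol (Averaging.iter (fun i => BlockAveraging.blockAvg (P := F.P K) (j := i) T3UnitLawDensityEML.ℰp) j U) p) / Real.sqrt (γ * ((F.L :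 ℝ)⁻¹) ^ (K - j)))) ∂(T3UnitScaleTilt.gibbsK F T3UnitLawDensityEML.ℰp γ K) ≤ D * (F.scheme T3UnitLawDensityEML.ℰp γ).β (K - j) ^ A * Real.exp (H * t ^ 2) := by
  sorry

/-! ## §2 The crux of the route and the crux of `UnitScaleTilt` BY NAME — no sorry below this line -/

/-- COMPOSITION (kernel-checked, no sorry): the two regime stubs give the route crux BY NAME. -/
theorem WindowMGFL_of (h₁ : open Literature.MathematicalPhysics.QuantumFieldTheory.Balaban1983to89 Literature.MathematicalPhysics.QuantumFieldTheory.Balaban1983to89.T3ContinuumYM3Torus in ∀ (L : ℕ), ∃ ε₀ : ℝ, 0 < ε₀ ∧ ∀ (ε : ℝ), 0 < ε → ε ≤ ε₀ → ∃ γ₁ : ℝ, 0 < γ₁ ∧ γ₁ ≤ 1 ∧ ∀ (F : T3Family) (γ : ℝ), F.L = L → 0 < γ → γ ≤ γ₁ → ∃ H₀ : ℝ, 0 < H₀ ∧ ∀ (H : ℝ), H₀ ≤ H → ∃ A₀ : ℕ, ∀ (A : ℕ), A₀ ≤ A → ∃ D : ℝ, 0 ≤ D ∧ ∀ (K j : ℕ),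 1 ≤ j → j ≤ K → 2 * j ≤ K → ∀ (p : Plaq (F.P K) j) (t : ℝ), 0 ≤ t → t ≤ (F.scheme T3UnitLawDensityEML.ℰp γ).β (K - j) ^ ε → ∫ U, Real.exp (t * (GaugeGroup.dist1 (GaugeField.plaqHol (Averaging.iter (fun i => BlockAveraging.blockAvg (P := F.P K) (j := i) T3UnitLawDensityEML.ℰp) j U) p) / Real.sqrt (γ * ((F.L : ℝ)⁻¹) ^ (K - j)))) ∂(T3UnitScaleTilt.gibbsK F T3UnitLawDensityEML.ℰp γ K) ≤ D * (F.scheme T3UnitLawDensityEML.ℰp γ).β (K - j) ^ A * Real.exp (H * t ^ 2)) (h₂ : open Literature.MathematicalPhysics.QuantumFieldTheory.Balaban1983to89 Literature.MathematicalPhysics.QuantumFieldTheory.Balaban1983to89.T3ContinuumYM3Torus in ∀ (L : ℕ), ∃ ε₀ : ℝ, 0 < ε₀ ∧ ∀ (ε : ℝ), 0 < ε → ε ≤ ε₀ → ∃ γ₁ : ℝ, 0 < γ₁ ∧ γ₁ ≤ 1 ∧ ∀ (F : T3Family) (γ : ℝ), F.L = L → 0 < γ → γ ≤ γ₁ → ∃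 H₀ : ℝ, 0 < H₀ ∧ ∀ (H : ℝ), H₀ ≤ H → ∃ A₀ : ℕ, ∀ (A : ℕ), A₀ ≤ A → ∃ D : ℝ, 0 ≤ D ∧ ∀ (K j : ℕ), 1 ≤ j → j ≤ K → K < 2 * j → ∀ (p : Plaq (F.P K) j) (t : ℝ), 0 ≤ t → t ≤ (F.scheme T3UnitLawDensityEML.ℰp γ).β (K - j) ^ ε → ∫ U, Real.exp (t * (GaugeGroup.dist1 (GaugeField.plaqHol (Averaging.iter (fun i => BlockAveraging.blockAvg (P := F.P K) (j := i) T3UnitLawDensityEML.ℰp) j U) p) / Real.sqrt (γ * ((F.L : ℝ)⁻¹) ^ (K - j)))) ∂(T3UnitScaleTilt.gibbsK F T3UnitLawDensityEML.ℰp γ K) ≤ D * (F.scheme T3UnitLawDensityEML.ℰp γ).β (K - j) ^ A * Real.exp (H * t ^ 2)) : WindowMGFL := by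
  intro L
  obtain ⟨ε₁, hε₁, H₁⟩ := h₁ L
  obtain ⟨ε₂, hε₂, H₂⟩ := h₂ L
  have hε : 0 < min ε₁ ε₂ := lt_min hε₁ hε₂
  obtain ⟨γ₁, hγ₁, hγ₁1, G₁⟩ := H₁ (min ε₁ ε₂) hε (min_le_left _ _)
  obtain ⟨γ₂, hγ₂, hγ₂1, G₂⟩ := H₂ (min ε₁ ε₂) hε (min_le_right _ _)
  refine ⟨min ε₁ ε₂, hε, min γ₁ γ₂, lt_min hγ₁ hγ₂, (min_le_left _ _).trans hγ₁1, ?_⟩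
  intro F γ hF hγ hγle
  obtain ⟨C₁, hC₁, K₁⟩ := G₁ F γ hF hγ (hγle.trans (min_le_left _ _))
  obtain ⟨C₂, hC₂, K₂⟩ := G₂ F γ hF hγ (hγle.trans (min_le_right _ _))
  obtain ⟨A₁, M₁⟩ := K₁ (max C₁ C₂) (le_max_left _ _)
  obtain ⟨A₂, M₂⟩ := K₂ (max C₁ C₂) (le_max_right _ _)
  obtain ⟨D₁, hD₁, B₁⟩ := M₁ (max A₁ A₂) (le_max_left _ _)
  obtain ⟨D₂, hD₂, B₂⟩ := M₂ (max A₁ A₂) (le_max_right _ _)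
  refine ⟨max C₁ C₂, max D₁ D₂, max A₁ A₂, lt_max_of_lt_left hC₁, le_max_of_le_left hD₁, ?_⟩
  intro K j hj hjK p t ht0 ht
  have hβ : 0 ≤ (F.scheme Literature.MathematicalPhysics.QuantumFieldTheory.Balaban1983to89.T3UnitLawDensityEML.ℰp γ).β (K - j) ^ max A₁ A₂ *
      Real.exp (max C₁ C₂ * t ^ 2) :=
    mul_nonneg (pow_nonneg (F.scheme_β_nonneg _ hγ.le _) _) (Real.exp_nonneg _)
  by_cases hreg : 2 * j ≤ K
  · have hle := B₁ K j hj hjK hreg p t ht0 ht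
    calc _ ≤ _ := hle
      _ ≤ _ := by rw [mul_assoc, mul_assoc]; exact mul_le_mul_of_nonneg_right (le_max_left _ _) hβ
  · have hle := B₂ K j hj hjK (Nat.lt_of_not_le hreg) p t ht0 ht
    calc _ ≤ _ := hle
      _ ≤ _ := by rw [mul_assoc, mul_assoc]; exact mul_le_mul_of_nonneg_right (le_max_right _ _) hβ


/-- `UnitScaleTilt.HistoryTailL` BY NAME from the three stubs (the glue item applied to the joined regime stubs). -/
theorem HistoryTailL_of : Summit.QuantumFields.YangMills.Theses.UnitScaleTilt.HistoryTailL :=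
  stub_historyTailOfWindow (WindowMGFL_of stub_fineWindow stub_deepWindow)

end Summit.QuantumFields.YangMills.Cruxes.HistoryTailL.ModerateWindow
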